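import Summits.QuantumFields.BalabanUV.Beta.FP.StepLawWardGeneric
import Summits.QuantumFields.BalabanUV.Beta.FP.PerfectKernelSymmGeneric
import Summits.QuantumFields.BalabanUV.Beta.HessKerCoDressedBmWall
import Summits.QuantumFields.BalabanUV.Beta.SpineRootedBmN

/-!
# `BalabanUV.Beta.FP.RoadPinnedBm` — road «FP» for binder row D1, rows BM-PINS + BM-ROWS (m = 1) (owner ruling R-FP-13 (d)): ROAD FP's END FOR THE
# BLOCK-MEAN ROOTED FAMILY OF RECORD `SpineRooted.JsBalBmNAtOf hLc hr cE cVH cΛ W …` (an2's Π_bm-co-dressed native spine — the row's v2.23/v2.26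
# candidates are its table instances), with the K-slot rows in lane G-an2-4's ENTRYWISE currency and `hTsymm` DISCHARGED from the tables' (Wt) + swap symmetry

HONEST FRAMING (cell contract, verbatim): «discharging `BetaPertH` makes Bałaban's UV stability UNCONDITIONAL — a real constructive-QFT
result; it is NOT the continuum limit and NOT the Clay problem.»  THIS MODULE DISCHARGES NOTHING of D1 / BetaPertH: it plugs an2's family
`JsBalBmNAtOf … = dressBmAt hr ∘ JsBal0NAtOf …` (by `rfl`) into `StepLawWardGeneric.d1Drift_dressBmAt_of_ward_symm_explicitDefect`, transports the
K-slot rows from the ENTRYWISE currency of lane G-an2-4 (`Decays (unitK_j (KInvStep Lc j)) C δK` + all-scales deviations) to the co-dressed resolvents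
`coDressKBmAt (toSite r) Lc (KInvStep Lc j)` by asym1's `HessKerCoDressedBmWall.exists_coDressedBm_unit_rows` (window `R < δK/4`), and discharges the END's
binder `hTsymm` by `PerfectKernelSymmGeneric.hTsymm_TGenOf_one_dressBmAt` from (St♭) of the native stencils (an2's `SpineRooted.JsBal0NAtOf_S_translate`,
tree) and the tables' (Wt) + bond-swap symmetry (displayed hypotheses `hWt`, `hWsymm` — for an2's recursive tables they are `WbalOf_translate`/`WbalOf_swap`).
RESULT **`d1Drift_JsBalBmNAtOf_of_ward_explicitDefect`**: `D1Drift Lc (JsBalBmNAtOf hLc hr cE cVH cΛ W Cw δw hδw hW) N μ ν` ⟸ EXACTLY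
{ENTRYWISE K-slot rows (G-an2-4), stencil rows of the native stencils and table rows (m = 1), the pins `hG1`/`hS1`/`hW1` + class data of the perfect
objects (m ≥ 1; m ≥ 2 = row BM-ROWS-REBASE), `hWt`/`hWsymm` of the tables, **`hWf`** (Ward row of the flipped perfect one-step kernel — row HH-INHERIT-G ⟸ the
tree's finite-j letters), **`hSDF`** (explicit defect), **`hasym`** (N7)}.  NOT «D1 closed», NOT BetaPertH, NOT continuum, NOT Clay.
ABSOLUTE RULE (cell, verbatim): «No internally-minted statement may enter as a cited fact. Every hypothesis is either kernel-proved in this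
package or a verbatim quotation of a PUBLISHED theorem with page reference.»  Nothing cited; no `def … : Prop`; no binder instantiated at a value
(colour weights, tables, root, units, constants universally bound — RULING (R18-3)).
HONEST DEPENDENCY (verbatim): «continuum YM on T⁴ ⇐ BetaPertH ∧ nine spine estimates (0/9 proved); BetaPertH ⇐ (D1) ∧ (D4) ∧ CAP+tail;
G-an2-4 gates asym, D1 and NE2/3/4.»
Provenance: road FP owner b2b-balaban-beta-d1-p3 gen 3, 2026-08-20; over an2 `SpineRootedBmN`/`AxialDressingRootedBmHessian`, asym1 `HessKerCoDressedBmWall`,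
owner `RoadEndGeneric`/`StepLawWardGeneric`/`PerfectKernelSymmGeneric` BY NAME.  [our object], 0 `def`, 0 cite, 0 sorry.
-/

noncomputable section

namespace Summit.QuantumFields.BalabanUV.Beta.FP.RoadPinnedBm

open Filter Topology
open Literature.MathematicalPhysics.QuantumFieldTheory.Balaban1983to89
open Literature.MathematicalPhysics.QuantumFieldTheory.Balaban1983to89.Beta
open B12Beta (secondMoment)
open B12Normalization (stepBal)
open DressedMomentNormalisation (EKer dressedEntry)
open ExpKernelCalculus (MKer Decays VertexFamily₂ shiftK)
open PolarizationSign (WardTransversal)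
open OneStepResolventKernel (Fib LocStencil JetData decays_mono)
open OneStepKernelFamily (KInvStep TbalOf flipK D1Drift)
open AffineAveraging (box toSite)
open Summit.QuantumFields.BalabanUV.Beta.HessKerDressedUnits (unitK unitS unitW)
open Summit.QuantumFields.BalabanUV.Beta.AxialDressingRooted (dressBmAt coDressKBmAt)
open Summit.QuantumFields.BalabanUV.Beta.HessKerCoDressedBmWall (exists_coDressedBm_unit_rows)
open Summit.QuantumFields.BalabanUV.Beta.SpineRooted (JsBal0NAtOf JsBalBmNAtOf JsBal0NAtOf_W JsBal0NAtOf_S_translate)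
open Summit.QuantumFields.BalabanUV.Beta.GAN24.CombesThomas (sfStep smStep)
open Summit.QuantumFields.BalabanUV.Beta.FP.PerfectObjectsT (KPerf SPerfOf WPerfOf)
open Summit.QuantumFields.BalabanUV.Beta.FP.TransportInfinityM (colOf)
open Summit.QuantumFields.BalabanUV.Beta.FP.StepDefectInherit (defect)
open Summit.QuantumFields.BalabanUV.Beta.FP.RoadEndGeneric (KPerfOf TGenOf fPerfG)
open Summit.QuantumFields.BalabanUV.Beta.FP.StepLawWardGeneric (d1Drift_dressBmAt_of_ward_symm_explicitDefect)
open Summit.QuantumFields.BalabanUV.Beta.FP.PerfectKernelSymmGeneric (hTsymm_TGenOf_one_dressBmAt)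

variable {Lc : ℕ} [NeZero Lc] {r : Fin (3 + 1) → ℕ} (hr : r ∈ box (3 + 1) Lc) (cE cVH cΛ : ℝ)
  (W : ℕ → Fin (3 + 1) → (Fin (3 + 1) → ℤ) → Fin (3 + 1) → (Fin (3 + 1) → ℤ) → MKer (3 + 1) (Fib 3))
  (Cw' δw : ℕ → ℝ) (hδw : ∀ j, 0 < δw j) (hW' : ∀ j, VertexFamily₂ (W j) Lc (Cw' j) (δw j))
  (sf sm : ℕ → ℝ) (G : ℕ → ℕ → MKer (3 + 1) (Fib 3)) (S : ℕ → ℕ → Fin (3 + 1) → (Fin (3 + 1) → ℤ) → MKer (3 + 1) (Fib 3))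
  (Wt : ℕ → ℕ → Fin (3 + 1) → (Fin (3 + 1) → ℤ) → Fin (3 + 1) → (Fin (3 + 1) → ℤ) → MKer (3 + 1) (Fib 3))
  {R C cK δK Cs cS δS Cw cW δW θ : ℝ}

/-- **ROAD «FP», THE END FOR THE BLOCK-MEAN ROOTED FAMILY OF RECORD `JsBalBmNAtOf`** (`d = 3`, `2 ≤ Lc`, in-block root `r`; bounded-defect form).
`D1Drift Lc (JsBalBmNAtOf hLc hr cE cVH cΛ W Cw δw hδw hW) N μ ν` ⟸ EXACTLY: the ENTRYWISE K-slot rows of lane G-an2-4 (`hK`/`hKall` on `unitK_j (KInvStep Lc j)`,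
window `R < δK/4`), stencil rows on the native stencils `unitS_j (JsBal0NAtOf … j).S`, table rows on `unitW_j (W j)`, the pins `hG1`/`hS1`/`hW1` of the supplied
(j, m)-families with class data of their perfect limits (`m ≥ 1`), (Wt) `hWt` and bond-swap symmetry `hWsymm` of the tables, **`hWf`**, **`hSDF`** (explicit
defect against the undressed perfect column), **`hasym`**.  `hTsymm` is DISCHARGED (St♭ of the native stencils is an2's tree theorem); the co-dressed K-rows are
DERIVED (asym1).  Discharges nothing by itself; NOT «D1 closed». -/
theorem d1Drift_JsBalBmNAtOf_of_ward_explicitDefect (hLc2 : 2 ≤ Lc) (hsf : ∀ j, sf j ≠ 0) (hsm : ∀ j, sm j ≠ 0)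
    (hG1 : ∀ j, G j 1 = coDressKBmAt (toSite r) Lc (KInvStep (d := 3) Lc j))
    (hS1 : ∀ j, S j 1 = (JsBal0NAtOf (Nat.one_le_of_lt hLc2) hr cE cVH cΛ W Cw' δw hδw hW' j).S) (hW1 : ∀ j, Wt j 1 = W j)
    (hK : ∀ j, Decays (unitK (sf j) (sm j) (KInvStep (d := 3) Lc j)) C δK)
    (hKall : ∀ k j, Decays (unitK (sf (k + j)) (sm (k + j)) (KInvStep (d := 3) Lc (k + j)) - unitK (sf k) (sm k) (KInvStep (d := 3) Lc k))
      (cK * θ ^ k) δK)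
    (hS : ∀ j, LocStencil (unitS (sf j) (sm j) (JsBal0NAtOf (Nat.one_le_of_lt hLc2) hr cE cVH cΛ W Cw' δw hδw hW' j).S) Cs δS)
    (hSall : ∀ k j, LocStencil (unitS (sf (k + j)) (sm (k + j)) (JsBal0NAtOf (Nat.one_le_of_lt hLc2) hr cE cVH cΛ W Cw' δw hδw hW' (k + j)).S -
      unitS (sf k) (sm k) (JsBal0NAtOf (Nat.one_le_of_lt hLc2) hr cE cVH cΛ W Cw' δw hδw hW' k).S) (cS * θ ^ k) δS)
    (hW : ∀ j, VertexFamily₂ (unitW (sf j) (sm j) (W j)) Lc Cw δW)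
    (hWall : ∀ k j, VertexFamily₂ (unitW (sf (k + j)) (sm (k + j)) (W (k + j)) - unitW (sf k) (sm k) (W k)) Lc (cW * θ ^ k) δW)
    (hδK : 0 < δK) (hR : 0 < R) (hRK : R < δK / 4) (hRS : R / 2 < δS) (hRW : R < δW) (hθ0 : 0 ≤ θ) (hθ1 : θ < 1)
    (hGinf : ∀ m : ℕ, 1 ≤ m → ∃ δ C : ℝ, 0 < δ ∧ 0 ≤ C ∧ Decays (KPerfOf (d := 3) sf sm G m) C δ)
    (hSinf : ∀ m : ℕ, 1 ≤ m → ∃ Cs δS : ℝ, 0 < δS ∧ LocStencil (SPerfOf sf sm S m) Cs δS)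
    (hWinf : ∀ m : ℕ, 1 ≤ m → ∃ Cw δW : ℝ, 0 < δW ∧ VertexFamily₂ (WPerfOf sf sm Wt m) (Lc ^ m) Cw δW)
    (hWt : ∀ (j : ℕ) (μ : Fin (3 + 1)) (y : Fin (3 + 1) → ℤ) (ν : Fin (3 + 1)) (y' t : Fin (3 + 1) → ℤ),
      W j μ (y + t) ν (y' + t) = shiftK (-((Lc : ℤ) • t)) (W j μ y ν y'))
    (hWsymm : ∀ (j : ℕ) (μ : Fin (3 + 1)) (y : Fin (3 + 1) → ℤ) (ν : Fin (3 + 1)) (y' : Fin (3 + 1) → ℤ), W j μ y ν y' = W j ν y' μ y)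
    (hWf : WardTransversal (flipK (TGenOf Lc (KPerfOf sf sm G 1) (KPerfOf sf sm G 1) (SPerfOf sf sm S 1) (WPerfOf sf sm Wt 1))))
    (μ ν : Fin 4)
    (hSDF : ∀ m : ℕ, 1 ≤ m → secondMoment (defect
      (fun m => TGenOf (Lc ^ m) (KPerfOf sf sm G m) (KPerfOf sf sm G m) (SPerfOf sf sm S m) (WPerfOf sf sm Wt m))
      (fun m a b z => ((Lc ^ m : ℕ) : ℝ) ^ 8 * dressedEntry (colOf (KPerf (d := 3) Lc (sfStep Lc) (smStep 3 Lc) m))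
        (TGenOf Lc (KPerfOf sf sm G 1) (KPerfOf sf sm G 1) (SPerfOf sf sm S 1) (WPerfOf sf sm Wt 1))
        (((Lc ^ m : ℕ) : ℤ) • z) a b) m) μ ν = 0)
    {N Cg : ℝ} (hasym : ∀ m : ℕ, 1 ≤ m → |fPerfG Lc sf sm G G S Wt μ ν m - (m : ℝ) * stepBal N Lc| ≤ Cg) :
    D1Drift Lc (JsBalBmNAtOf (Nat.one_le_of_lt hLc2) hr cE cVH cΛ W Cw' δw hδw hW') N μ ν := by
  have hLc : 1 ≤ Lc := Nat.one_le_of_lt hLc2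
  -- the co-dressed K-rows from the entrywise ones (asym1), at `(c·C, δK/4, c·c_K, θ)`
  obtain ⟨c, hc0, hGrow, hGall⟩ := exists_coDressedBm_unit_rows (N := Lc) hLc hr sf sm hsf hsm (K := fun j => KInvStep (d := 3) Lc j) hδK hK hKall
  -- the tables of the native spine ARE the supplied `W j`
  have eW : ∀ j, (JsBal0NAtOf hLc hr cE cVH cΛ W Cw' δw hδw hW' j).W = W j := fun j => JsBal0NAtOf_W hLc hr cE cVH cΛ W Cw' δw hδw hW' j
  have hW1' : ∀ j, Wt j 1 = (JsBal0NAtOf hLc hr cE cVH cΛ W Cw' δw hδw hW' j).W := fun j => by rw [eW]; exact hW1 j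
  have hWrow : ∀ j, VertexFamily₂ (unitW (sf j) (sm j) (JsBal0NAtOf hLc hr cE cVH cΛ W Cw' δw hδw hW' j).W) Lc Cw δW := fun j => by
    rw [eW]; exact hW j
  have hWallrow : ∀ k j, VertexFamily₂ (unitW (sf (k + j)) (sm (k + j)) (JsBal0NAtOf hLc hr cE cVH cΛ W Cw' δw hδw hW' (k + j)).W -
      unitW (sf k) (sm k) (JsBal0NAtOf hLc hr cE cVH cΛ W Cw' δw hδw hW' k).W) Lc (cW * θ ^ k) δW := fun k j => by
    rw [eW, eW]; exact hWall k j
  have hWt' : ∀ (j : ℕ) (μ : Fin (3 + 1)) (y : Fin (3 + 1) → ℤ) (ν : Fin (3 + 1)) (y' t : Fin (3 + 1) → ℤ),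
      (JsBal0NAtOf hLc hr cE cVH cΛ W Cw' δw hδw hW' j).W μ (y + t) ν (y' + t) =
        shiftK (-((Lc : ℤ) • t)) ((JsBal0NAtOf hLc hr cE cVH cΛ W Cw' δw hδw hW' j).W μ y ν y') := fun j => by rw [eW]; exact hWt j
  have hWsymm' : ∀ (j : ℕ) (μ : Fin (3 + 1)) (y : Fin (3 + 1) → ℤ) (ν : Fin (3 + 1)) (y' : Fin (3 + 1) → ℤ),
      (JsBal0NAtOf hLc hr cE cVH cΛ W Cw' δw hδw hW' j).W μ y ν y' = (JsBal0NAtOf hLc hr cE cVH cΛ W Cw' δw hδw hW' j).W ν y' μ y := fun j => by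
    rw [eW]; exact hWsymm j
  -- `hTsymm` from (St♭) of the native stencils (tree) and (Wt) + swap symmetry of the tables
  obtain ⟨δ1, C1, hδ1, -, hG1inf⟩ := hGinf 1 le_rfl
  obtain ⟨Cs1, δS1, hδS1, hS1inf⟩ := hSinf 1 le_rfl
  have hTsymm := hTsymm_TGenOf_one_dressBmAt (r := r) (JsBal0NAtOf hLc hr cE cVH cΛ W Cw' δw hδw hW') sf sm G S Wt hG1 hS1 hW1' hG1inf hδ1
    hS1inf hδS1 (JsBal0NAtOf_S_translate hLc hr cE cVH cΛ W Cw' δw hδw hW') hWt' hWsymm'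
  -- the generic END at the block-mean family
  exact d1Drift_dressBmAt_of_ward_symm_explicitDefect hr (JsBal0NAtOf hLc hr cE cVH cΛ W Cw' δw hδw hW') sf sm G S Wt hLc2 hsf hsm hG1 hS1 hW1'
    hGrow hGall hS hSall hWrow hWallrow hR (by linarith) hRS hRW hθ0 hθ1 hGinf hSinf hWinf hWf hTsymm μ ν hSDF hasym

end Summit.QuantumFields.BalabanUV.Beta.FP.RoadPinnedBm

end
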